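import Literature.NumberTheory.EllipticCurves.HeegnerPointsKolyvaginLocalCriterion
import Literature.NumberTheory.EllipticCurves.SelmerLocalConditionGoodReductionProofs
import Literature.NumberTheory.EllipticCurves.OrdinaryLocalCondition
import HarnessLib

/-!
# Route `KolyvaginRoadThree`, deciding crux `ZhangSharpFrameAtThreeHL` (item stmt-BirchSwinnertonDyer-19574):
# the LOCAL PICTURE of `H¹(K_v, E[n])` at a good place through a NON-TRIVIAL Frobenius — cocycle criteria for
# the strict, the Kummer (= unramified) and the ORDINARY local conditions, and the two local inputs (Trans), (Line)
# of stub A `stub_levelRaisingAtThree` in structural form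
# (cell `bsd-stepL`, seat `bsd-stepL-zhang3-p1` g7; `--supports stmt-BirchSwinnertonDyer-19574`, helper)

WHY THIS FILE. koly3a's `Theorems/KolyvaginRoadThreeMethod2RankLoweringGood.lean` (p464695 ∕ p467211) reduced the
registered stub A of crux 19574 ((A1) rank lowering on good levels) to five local–global inputs at a good
unipotent-admissible prime `q` (inert in `K`, `v ∣ q`): (Cheb), (Equiv), (Line), (Trans), (Iso). Two of them are
statements about `H¹(K_v, E[3])` alone: (Line) — the localisations at `v` of the classes satisfying E's Kummer condition
at `v` are the integer multiples of ONE local class; (Trans) — a class satisfying the Kummer AND the ordinary condition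
at `v` has localisation ZERO (`H¹_f ∩ H¹_ord = 0`, Bertolini–Darmon 2005 Lemma 2.6 ∕ koly MEMO-v1 U4 at `p = 3`). The
tree's Kolyvagin machinery (`HeegnerPointsKolyvaginLocalCriterion`, Gross 1991 Prop. 9.6) treats a Frobenius acting
TRIVIALLY on `E[n]`; this file runs it — `G_𝔓 = res Γ_{K_v}` (Neukirch II (9.6)), `G_𝔓 = ⟨Frob⟩ · I_𝔓 · U` (Neukirch
I (9.4)), inertia trivial on `E[n]` at a good `v ∤ n` (Silverman VII.4.1), Kummer = unramified (Gross (7.1), tree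
`selmerLocalKer_eq_unramifiedKer`) — for an ARBITRARY arithmetic Frobenius `F` at `𝔓 ∣ v`: §1 a cocycle vanishing
at `F`, on `I_𝔓` and on an open subgroup vanishes on `G_𝔓`; §2 `loc_v x = 0 ⟺ φ_x|_{G_𝔓}` is a coboundary, and `x`
ordinary at `v ⟺ φ_x ≡ ∂P + (G_𝔓-fixed values)` on `G_𝔓`; §3 for unramified `x`: `loc_v x = 0 ⟺ φ_x(F) ∈ (F − 1)E[n]`;
§4 (Trans): if `E[n]^F ⊆ (F − 1)E[n]` then `selmerLocalKer ⊓ ordinaryLocalKer ≤ torsionLocalKer`; §5 (Line): if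
`E[n]/(F − 1)E[n]` has prime order or is trivial, the localisations of `selmerLocalKer` are the multiples of one class.
At a good unipotent-admissible prime of a curve over `ℚ` at `p = 3` (`Frob_v = ρ̄(Frob_q)² ∈ SL₂(𝔽₃) ∖ {1}`: `−1` or
unipotent `≠ 1`) both structural hypotheses hold; that specialisation (koly3a's typed binders verbatim) is a separate file.

HONEST FRAMING: theorems only (no definition, no named fact, no `sorry`); pure local–global Galois cohomology of an
elliptic curve over a number field; nothing about Heegner points or the crux is asserted; nothing is booked.
PARTITION: O2@3 (B10) × A1 × crux 19574 × stub A — none (kernel discharge of typed local inputs; closes nothing; T7).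

References: [cite: GrossLMS1991, §7 (7.1), §9 Prop. 9.6] [cite: NeukirchANT1999, Ch. I §9 (9.4), Ch. II §9 (9.6)]
[cite: SilvermanAEC2009, Prop. VII.4.1, Cor. III.6.4(b)] [cite: BertoliniDarmon2005, §2.2 Lemma 2.6]
[cite: WZhang2014, §4.1 (H¹_ord, H¹_fin), Prop. 5.4].
-/

noncomputable section

open scoped Classical Pointwise
open WeierstrassCurve NumberField IsDedekindDomain Field
open Literature.NumberTheory.EllipticCurves Literature.NumberTheory.GaloisRepresentations

universe u

namespace Summit.BirchSwinnertonDyer.Rank1Residual.X11b.Three.Koly.Method2.LocalFrob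

variable {K : Type u} [Field K] [NumberField K] (W : WeierstrassCurve K) {v : HeightOneSpectrum (𝓞 K)}

/-! ## §1 The engine: vanishing on a decomposition group -/

/-- **A cocycle vanishing at a Frobenius, on the inertia group and on an open subgroup vanishes on the whole
decomposition group.** For a prime `𝔓 ∣ v` of `\bar ℤ_K`, an arithmetic Frobenius `F` at `𝔓`, an open subgroup
`U ≤ Γ_K` and a continuous crossed homomorphism `φ : Γ_K → E[n]` with `φ(F) = 0`, `φ|_{I_𝔓} = 0`, `φ|_U = 0`:
`φ|_{G_𝔓} = 0`. Every `d ∈ G_𝔓` is `Fᵏ · i · u` (tree `exists_eq_frobenius_pow_mul_of_mem_decompositionSubgroup`,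
Neukirch I (9.4)), and `φ(Fᵏ i u) = φ(Fᵏ) + Fᵏ(φ(i) + i φ(u))`, `φ(Fᵏ) = 0` by induction on the cocycle identity.
[cite: NeukirchANT1999, Ch. I §9 Prop. (9.4)] -/
theorem cocycle_apply_eq_zero_of_mem_decompositionSubgroup {𝔓 : Ideal (absIntegers (𝓞 K) K)}
    (h𝔓 : 𝔓 ∈ v.primesAbove) {n : ℤ} {F : absoluteGaloisGroup K} (hF : IsArithFrobAt (𝓞 K) F 𝔓)
    (φ : contOneCocycles (discreteTopRep (absoluteGaloisGroup K) (geomTorsion W n)))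
    (hφF : φ.1 F = 0) (hφI : ∀ i ∈ 𝔓.inertia (absoluteGaloisGroup K), φ.1 i = 0)
    {U : Subgroup (absoluteGaloisGroup K)} (hU : IsOpen (U : Set (absoluteGaloisGroup K)))
    (hφU : ∀ u ∈ U, φ.1 u = 0)
    {d : absoluteGaloisGroup K} (hd : d ∈ 𝔓.decompositionSubgroup (absoluteGaloisGroup K)) :
    φ.1 d = 0 := by
  obtain ⟨k, i, u, hi, hu, rfl⟩ := exists_eq_frobenius_pow_mul_of_mem_decompositionSubgroup h𝔓 hF hU hd
  have hpow : ∀ k : ℕ, φ.1 (F ^ k) = 0 := by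
    intro k
    induction k with
    | zero => rw [pow_zero]; exact contOneCocycles.apply_one φ
    | succ k ih => rw [pow_succ, φ.2, ih, discreteTopRep_ρ_apply, hφF, smul_zero, add_zero]
  rw [φ.2, φ.2, hpow, discreteTopRep_ρ_apply, discreteTopRep_ρ_apply, hφI i hi, hφU u hu, smul_zero,
    add_zero, smul_zero, add_zero]

omit [NumberField K] in
/-- **Every cocycle vanishes on an open subgroup** (for an elliptic curve and `n ≠ 0`): on `Γ_{K(E[n])}` (open,
`isOpen_torsionFixing`) a cocycle is a continuous homomorphism into the discrete `E[n]`, and its kernel there is an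
open subgroup of `Γ_K`. [folklore] -/
theorem exists_isOpen_subgroup_apply_eq_zero [W.IsElliptic] {n : ℤ} (hn : n ≠ 0)
    (φ : contOneCocycles (discreteTopRep (absoluteGaloisGroup K) (geomTorsion W n))) :
    ∃ U : Subgroup (absoluteGaloisGroup K), IsOpen (U : Set (absoluteGaloisGroup K)) ∧ ∀ u ∈ U, φ.1 u = 0 := by
  refine ⟨{ carrier := {u | u ∈ torsionFixing W n ∧ φ.1 u = 0}
            mul_mem' := fun {a b} ha hb ↦ ⟨mul_mem ha.1 hb.1, by
              rw [φ.2, discreteTopRep_ρ_apply, smul_eq_of_mem_torsionFixing W n ha.1, ha.2, hb.2, add_zero]⟩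
            one_mem' := ⟨one_mem _, contOneCocycles.apply_one φ⟩
            inv_mem' := fun {a} ha ↦ ⟨inv_mem ha.1, by
              have h := φ.2 a⁻¹ a
              rw [inv_mul_cancel, contOneCocycles.apply_one, discreteTopRep_ρ_apply] at h
              have h2 : a⁻¹ • φ.1 a = 0 := by rw [ha.2, smul_zero]
              rw [h2, add_zero] at h
              exact h.symm⟩ }, ?_, fun u hu ↦ hu.2⟩
  change IsOpen {u : absoluteGaloisGroup K | u ∈ torsionFixing W n ∧ φ.1 u = 0}
  exact (isOpen_torsionFixing W hn).and ((isOpen_discrete ({0} : Set (geomTorsion W n))).preimage φ.1.continuous)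

omit [NumberField K] in
/-- **Subtracting a coboundary.** For a cocycle `φ : Γ_K → E[n]` and `P ∈ E[n]` there is a cocycle `φ'` of the SAME
class with `φ'(g) = φ(g) − (gP − P)` (the coboundary `∂P : g ↦ gP − P` is a continuous cocycle of class `0`).
[folklore] -/
theorem exists_cocycle_sub_coboundary [W.IsElliptic] {n : ℤ}
    (φ : contOneCocycles (discreteTopRep (absoluteGaloisGroup K) (geomTorsion W n))) (P : geomTorsion W n) :
    ∃ φ' : contOneCocycles (discreteTopRep (absoluteGaloisGroup K) (geomTorsion W n)),
      oneCocycleClass _ φ' = oneCocycleClass _ φ ∧ ∀ g, φ'.1 g = φ.1 g - (g • P - P) := by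
  haveI := continuousSMul_geomTorsion W (isOpen_stabilizer_point_holds W) n
  let cob : contOneCocycles (discreteTopRep (absoluteGaloisGroup K) (geomTorsion W n)) :=
    ⟨⟨fun g ↦ g • P - P, (continuous_id.smul continuous_const).sub continuous_const⟩, fun g h ↦ by
      change (g * h) • P - P = (g • P - P) + g • (h • P - P)
      rw [mul_smul, smul_sub]; abel⟩
  have hcob : oneCocycleClass _ cob = 0 := (oneCocycleClass_eq_zero_iff _ cob).mpr ⟨P, fun _ ↦ rfl⟩
  refine ⟨φ - cob, by rw [oneCocycleClass_sub, hcob, sub_zero], fun g ↦ rfl⟩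

/-! ## §2 Cocycle criteria on the decomposition group: strict and ordinary local conditions -/

section Criteria

variable [W.IsElliptic]

/-- **`loc_v x = 0 ⟺ φ_x|_{G_𝔓}` is a coboundary.** For `𝔐` a prime of `\bar 𝓞_v` above `𝓂_v` and
`𝔓 = 𝔓_{ι₀,𝔐}` the prime of `\bar ℤ_K` cut out by the chosen embedding `ι₀ : K̄ → K̄_v` (so `G_𝔓 = res(Γ_{K_v})`,
Neukirch II (9.6), and `E(K̄)[n] ⥲ E(K̄_v)[n]`): the class of a cocycle `φ` lies in `torsionLocalKer` (localisation
zero in `H¹(K_v, E[n])`) iff `φ(d) = dP − P` on `G_𝔓` for some `P ∈ E[n]`.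
[cite: NeukirchANT1999, Ch. II §9 Prop. (9.6)] [cite: GrossLMS1991, Prop. 9.6 (proof)] -/
theorem oneCocycleClass_mem_torsionLocalKer_iff {n : ℕ} (hn : n ≠ 0)
    {𝔐 : Ideal (HeightOneSpectrum.localAbsIntegers v)} (h𝔐 : 𝔐 ∈ v.localPrimesAbove)
    (φ : contOneCocycles (discreteTopRep (absoluteGaloisGroup K) (geomTorsion W (n : ℤ)))) :
    oneCocycleClass _ φ ∈ W.torsionLocalKer (v.adicCompletion K) n ↔
      ∃ P : geomTorsion W (n : ℤ), ∀ d ∈ (v.primeBelow (closureEmb (K := K) (v.adicCompletion K)) 𝔐).decompositionSubgroup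
        (absoluteGaloisGroup K), φ.1 d = d • P - P := by
  haveI : CharZero (v.adicCompletion K) :=
    charZero_of_injective_algebraMap (algebraMap K (v.adicCompletion K)).injective
  set ι₀ := closureEmb (K := K) (v.adicCompletion K) with hι₀
  have hbij := torsionPointsMap_bijective W (v.adicCompletion K) hn
  rw [show oneCocycleClass _ φ ∈ W.torsionLocalKer (v.adicCompletion K) n ↔
      ∃ Q : AddSubgroup.torsionBy (localPoints W (v.adicCompletion K)) (n : ℤ),
        ∀ g : absoluteGaloisGroup (v.adicCompletion K),
          torsionPointsMap W (v.adicCompletion K) n (φ.1 (resGal (K := K) (v.adicCompletion K) g)) = g • Q - Q from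
    oneCocycleClass_mem_resKer_iff _ _ _ φ]
  constructor
  · rintro ⟨Q, hQ⟩
    obtain ⟨P, rfl⟩ := hbij.2 Q
    refine ⟨P, fun d hd ↦ ?_⟩
    obtain ⟨σ, hσ⟩ := exists_apply_eq_smul_of_mem_decompositionSubgroup ι₀ h𝔐 hd
    have hres : resGal (K := K) (v.adicCompletion K) σ = d := by
      rw [resGal_eq]; exact resGalOfEmb_eq_of_apply_eq ι₀ hσ
    have h := hQ σ
    rw [hres, ← torsionPointsMap_smul, hres, ← map_sub] at h
    exact hbij.1 h
  · rintro ⟨P, hP⟩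
    refine ⟨torsionPointsMap W (v.adicCompletion K) n P, fun g ↦ ?_⟩
    have hd : resGal (K := K) (v.adicCompletion K) g ∈
        (v.primeBelow ι₀ 𝔐).decompositionSubgroup (absoluteGaloisGroup K) := by
      rw [resGal_eq]; exact resGalOfEmb_mem_decompositionSubgroup ι₀ h𝔐 g
    rw [hP _ hd, map_sub, torsionPointsMap_smul]

omit [W.IsElliptic] in
/-- The localisation of the class of `φ` is the class of the pulled-back cocycle `g ↦ (φ (res g))|_{K̄_v}`
(Mathlib `ContinuousCohomology.map` on explicit cocycles, tree `map_oneCocycleClass`). [folklore] -/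
theorem torsionLocMap_oneCocycleClass (n : ℤ)
    (φ : contOneCocycles (discreteTopRep (absoluteGaloisGroup K) (geomTorsion W n))) :
    W.torsionLocMap (v.adicCompletion K) n (oneCocycleClass _ φ) =
      oneCocycleClass _ (contOneCocycles.pullback (resGal (K := K) (v.adicCompletion K))
        (resHomOfEquivariant (resGal (K := K) (v.adicCompletion K)) (torsionPointsMap W (v.adicCompletion K) n)
          (torsionPointsMap_smul W (v.adicCompletion K) n)) φ) := by
  unfold WeierstrassCurve.torsionLocMap
  simp only [LinearMap.toAddMonoidHom_coe, ContinuousLinearMap.coe_coe]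
  exact map_oneCocycleClass _ _ _ φ

/-- **The ordinary condition on the decomposition group.** With `𝔓 = 𝔓_{ι₀,𝔐}`: the class of a cocycle `φ`
satisfies the ORDINARY condition at `v` (Literature `ordinaryLocalKer`: localisation represented by a cocycle valued
in the `Γ_{K_v}`-fixed points of `E(K̄_v)[n]`) iff for some `P ∈ E[n]` the map `d ↦ φ(d) − (dP − P)` on `G_𝔓` takes
`G_𝔓`-fixed values (`⟹`: `φ∘res` minus such a cocycle is a local coboundary `∂Q`; `⟸`: `(φ − ∂P)∘res` is one).
[cite: BertoliniDarmon2005, §2.2 (H¹_ord)] [cite: WZhang2014, §4.1] -/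
theorem oneCocycleClass_mem_ordinaryLocalKer_iff {n : ℕ} (hn : n ≠ 0)
    {𝔐 : Ideal (HeightOneSpectrum.localAbsIntegers v)} (h𝔐 : 𝔐 ∈ v.localPrimesAbove)
    (φ : contOneCocycles (discreteTopRep (absoluteGaloisGroup K) (geomTorsion W (n : ℤ)))) :
    oneCocycleClass _ φ ∈ W.ordinaryLocalKer (v.adicCompletion K) n ↔
      ∃ P : geomTorsion W (n : ℤ),
        ∀ d ∈ (v.primeBelow (closureEmb (K := K) (v.adicCompletion K)) 𝔐).decompositionSubgroup (absoluteGaloisGroup K),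
        ∀ d' ∈ (v.primeBelow (closureEmb (K := K) (v.adicCompletion K)) 𝔐).decompositionSubgroup (absoluteGaloisGroup K),
          d' • (φ.1 d - (d • P - P)) = φ.1 d - (d • P - P) := by
  haveI : CharZero (v.adicCompletion K) :=
    charZero_of_injective_algebraMap (algebraMap K (v.adicCompletion K)).injective
  set ι₀ := closureEmb (K := K) (v.adicCompletion K) with hι₀
  set Kv := v.adicCompletion K with hKv
  have hbij := torsionPointsMap_bijective W Kv hn
  have hmem : ∀ x : galH1Torsion W (n : ℤ), x ∈ W.ordinaryLocalKer Kv n ↔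
      ∃ ψ : contOneCocycles (discreteTopRep (absoluteGaloisGroup Kv) (AddSubgroup.torsionBy (localPoints W Kv) (n : ℤ))),
        (∀ g, ψ.1 g ∈ FixedPoints.addSubgroup (absoluteGaloisGroup Kv) (AddSubgroup.torsionBy (localPoints W Kv) (n : ℤ)))
        ∧ oneCocycleClass _ ψ = W.torsionLocMap Kv n x := fun x ↦ by
    change x ∈ AddSubgroup.comap _ _ ↔ _
    rw [AddSubgroup.mem_comap]; rfl
  have hlift : ∀ d ∈ (v.primeBelow ι₀ 𝔐).decompositionSubgroup (absoluteGaloisGroup K),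
      ∃ σ : absoluteGaloisGroup Kv, resGal (K := K) Kv σ = d := fun d hd ↦ by
    obtain ⟨σ, hσ⟩ := exists_apply_eq_smul_of_mem_decompositionSubgroup ι₀ h𝔐 hd
    exact ⟨σ, by rw [resGal_eq]; exact resGalOfEmb_eq_of_apply_eq ι₀ hσ⟩
  have hresmem : ∀ g : absoluteGaloisGroup Kv,
      resGal (K := K) Kv g ∈ (v.primeBelow ι₀ 𝔐).decompositionSubgroup (absoluteGaloisGroup K) := fun g ↦ by
    rw [resGal_eq]; exact resGalOfEmb_mem_decompositionSubgroup ι₀ h𝔐 g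
  rw [hmem, torsionLocMap_oneCocycleClass]
  constructor
  · rintro ⟨ψ, hψL, hψ⟩
    -- `φ∘res − ψ` is a local coboundary `∂Q`
    have h0 : oneCocycleClass _ (contOneCocycles.pullback (resGal (K := K) Kv)
        (resHomOfEquivariant (resGal (K := K) Kv) (torsionPointsMap W Kv n) (torsionPointsMap_smul W Kv n)) φ - ψ) =
        0 := by rw [oneCocycleClass_sub, hψ, sub_self]
    obtain ⟨Q, hQ⟩ := (oneCocycleClass_eq_zero_iff _ _).mp h0
    obtain ⟨P, rfl⟩ := hbij.2 Q
    refine ⟨P, fun d hd d' hd' ↦ ?_⟩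
    obtain ⟨σ, rfl⟩ := hlift d hd
    obtain ⟨σ', rfl⟩ := hlift d' hd'
    -- the value `φ(res σ) − (res σ • P − P)` maps to `ψ σ ∈ L`
    have hval : torsionPointsMap W Kv n (φ.1 (resGal (K := K) Kv σ) - (resGal (K := K) Kv σ • P - P)) = ψ.1 σ := by
      have h := hQ σ
      rw [discreteTopRep_ρ_apply] at h
      change torsionPointsMap W Kv n (φ.1 (resGal (K := K) Kv σ)) - ψ.1 σ =
        σ • torsionPointsMap W Kv n P - torsionPointsMap W Kv n P at h
      rw [map_sub, map_sub, torsionPointsMap_smul, sub_eq_iff_eq_add.mp h]; abel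
    have hfix := hψL σ
    rw [FixedPoints.mem_addSubgroup] at hfix
    exact hbij.1 (by rw [torsionPointsMap_smul, hval, hfix σ'])
  · rintro ⟨P, hP⟩
    obtain ⟨φ', hφ', hφ'apply⟩ := exists_cocycle_sub_coboundary W φ P
    refine ⟨contOneCocycles.pullback (resGal (K := K) Kv)
        (resHomOfEquivariant (resGal (K := K) Kv) (torsionPointsMap W Kv n) (torsionPointsMap_smul W Kv n)) φ',
      fun g ↦ ?_, by rw [← torsionLocMap_oneCocycleClass, ← torsionLocMap_oneCocycleClass, hφ']⟩
    rw [contOneCocycles.pullback_apply, FixedPoints.mem_addSubgroup]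
    intro σ'
    change σ' • torsionPointsMap W Kv n (φ'.1 (resGal (K := K) Kv g)) = torsionPointsMap W Kv n (φ'.1 (resGal (K := K) Kv g))
    rw [← torsionPointsMap_smul, hφ'apply, hP _ (hresmem g) _ (hresmem σ')]

end Criteria

/-! ## §3 The strict condition at a NON-trivial Frobenius (Gross 9.6 generalised) -/

section Frobenius

variable [W.IsElliptic]

/-- **`loc_v x = 0 ⟺ φ_x(F) ∈ (F − 1)E[n]` for `x` unramified at `𝔓`.** Let `𝔓 = 𝔓_{ι₀,𝔐}`, `F` an arithmetic
Frobenius at `𝔓`, assume the inertia group `I_𝔓` acts trivially on `E[n]` (good `v ∤ n`: `inertia_le_torsionFixing`)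
and let `φ` be a cocycle vanishing on `I_𝔓` (an unramified class). Then the class of `φ` has localisation zero in
`H¹(K_v, E[n])` iff `φ(F) = Fm − m` for some `m ∈ E[n]` (for `F` trivial on `E[n]` — a Kolyvagin prime — this is the
tree's `mem_torsionLocalKer_iff_h1Eval_eq_zero`, Gross Prop. 9.6; `⟸`: `φ − ∂m` vanishes at `F`, on `I_𝔓`, on an open
subgroup, hence on `G_𝔓` by §1). [cite: GrossLMS1991, Prop. 9.6] [cite: NeukirchANT1999, Ch. I §9 Prop. (9.4)] -/
theorem oneCocycleClass_mem_torsionLocalKer_iff_apply_frob {n : ℕ} (hn : n ≠ 0)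
    {𝔐 : Ideal (HeightOneSpectrum.localAbsIntegers v)} (h𝔐 : 𝔐 ∈ v.localPrimesAbove)
    {F : absoluteGaloisGroup K}
    (hF : IsArithFrobAt (𝓞 K) F (v.primeBelow (closureEmb (K := K) (v.adicCompletion K)) 𝔐))
    (hI : (v.primeBelow (closureEmb (K := K) (v.adicCompletion K)) 𝔐).inertia (absoluteGaloisGroup K) ≤
      torsionFixing W n)
    (φ : contOneCocycles (discreteTopRep (absoluteGaloisGroup K) (geomTorsion W (n : ℤ))))
    (hφI : ∀ i ∈ (v.primeBelow (closureEmb (K := K) (v.adicCompletion K)) 𝔐).inertia (absoluteGaloisGroup K),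
      φ.1 i = 0) :
    oneCocycleClass _ φ ∈ W.torsionLocalKer (v.adicCompletion K) n ↔ ∃ m : geomTorsion W (n : ℤ), φ.1 F = F • m - m := by
  have h𝔓 := HeightOneSpectrum.primeBelow_mem_primesAbove (ι := closureEmb (K := K) (v.adicCompletion K)) h𝔐
  haveI := h𝔓.1
  constructor
  · intro hx
    obtain ⟨P, hP⟩ := (oneCocycleClass_mem_torsionLocalKer_iff W hn h𝔐 φ).mp hx
    exact ⟨P, hP F hF.mem_stabilizer⟩
  · rintro ⟨m, hm⟩
    obtain ⟨φ', hφ', hφ'apply⟩ := exists_cocycle_sub_coboundary W φ m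
    rw [← hφ', oneCocycleClass_mem_torsionLocalKer_iff W hn h𝔐 φ']
    refine ⟨0, fun d hd ↦ ?_⟩
    rw [smul_zero, sub_zero]
    have hn' : (n : ℤ) ≠ 0 := by exact_mod_cast hn
    obtain ⟨U, hU, hφ'U⟩ := exists_isOpen_subgroup_apply_eq_zero W hn' φ'
    refine cocycle_apply_eq_zero_of_mem_decompositionSubgroup W h𝔓 hF φ' ?_ (fun i hi ↦ ?_) hU hφ'U hd
    · rw [hφ'apply, hm, sub_self]
    · rw [hφ'apply, hφI i hi, smul_eq_of_mem_torsionFixing W n (hI hi), sub_self, sub_zero]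

/-- **Fixed points of the decomposition group = fixed points of the Frobenius** (on `E[n]`, when the inertia acts
trivially): `G_𝔓 = ⟨F⟩ · I_𝔓 · Γ_{K(E[n])}` (§1 with the open subgroup `Γ_{K(E[n])}`). [folklore] -/
theorem smul_eq_self_of_frob_smul_eq_self {𝔓 : Ideal (absIntegers (𝓞 K) K)} (h𝔓 : 𝔓 ∈ v.primesAbove)
    {n : ℤ} (hn : n ≠ 0) {F : absoluteGaloisGroup K} (hF : IsArithFrobAt (𝓞 K) F 𝔓)
    (hI : 𝔓.inertia (absoluteGaloisGroup K) ≤ torsionFixing W n)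
    {m : geomTorsion W n} (hm : F • m = m)
    {d : absoluteGaloisGroup K} (hd : d ∈ 𝔓.decompositionSubgroup (absoluteGaloisGroup K)) : d • m = m := by
  obtain ⟨k, i, u, hi, hu, rfl⟩ :=
    exists_eq_frobenius_pow_mul_of_mem_decompositionSubgroup h𝔓 hF (isOpen_torsionFixing W hn) hd
  have hpow : ∀ k : ℕ, F ^ k • m = m := by
    intro k
    induction k with
    | zero => rw [pow_zero, one_smul]
    | succ k ih => rw [pow_succ, mul_smul, hm, ih]
  rw [mul_smul, mul_smul, smul_eq_of_mem_torsionFixing W n hu, smul_eq_of_mem_torsionFixing W n (hI hi), hpow]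

end Frobenius

/-! ## §4 (Trans): `H¹_f ∩ H¹_ord = 0` when `E[n]^F ⊆ (F − 1)E[n]` -/

section Trans

variable [W.IsElliptic]

/-- **(Trans) in structural form.** Let `v` be a place of good reduction, `v ∤ n` (`n ≠ 0`), `𝔓 = 𝔓_{ι₀,𝔐}` and `F`
an arithmetic Frobenius at `𝔓`; assume every `F`-fixed point of `E[n]` lies in `(F − 1)E[n]`
(at a good unipotent-admissible prime for `p = 3`: `F = ρ̄(Frob_q)²` is `−1` or unipotent `≠ 1`). Then a class
satisfying BOTH the Kummer condition (`selmerLocalKer` = unramified at a good `v ∤ n`, Gross (7.1)) and the ordinary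
condition at `v` has localisation ZERO: `H¹_f(K_v, E[n]) ∩ H¹_ord = 0` (Bertolini–Darmon Lemma 2.6). Proof: `φ|_{I_𝔓}
= 0`; by §2 `φ(F) − (FP − P)` is `G_𝔓`-fixed for some `P`, hence `= Fm − m`, and §3 applies.
[cite: BertoliniDarmon2005, §2.2 Lemma 2.6] [cite: GrossLMS1991, §7 (7.1), Prop. 9.6] -/
theorem selmerLocalKer_inf_ordinaryLocalKer_le_torsionLocalKer (hgood : W.HasGoodReductionAt v) {n : ℕ} (hn : n ≠ 0)
    (hnv : ((n : ℤ) : 𝓞 K) ∉ v.asIdeal)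
    {𝔐 : Ideal (HeightOneSpectrum.localAbsIntegers v)} (h𝔐 : 𝔐 ∈ v.localPrimesAbove)
    {F : absoluteGaloisGroup K}
    (hF : IsArithFrobAt (𝓞 K) F (v.primeBelow (closureEmb (K := K) (v.adicCompletion K)) 𝔐))
    (hstruct : ∀ y : geomTorsion W (n : ℤ), F • y = y → ∃ m : geomTorsion W (n : ℤ), y = F • m - m) :
    selmerLocalKer W (v.adicCompletion K) n ⊓ W.ordinaryLocalKer (v.adicCompletion K) n ≤
      W.torsionLocalKer (v.adicCompletion K) n := by
  intro x hx
  obtain ⟨hsel, hord⟩ := AddSubgroup.mem_inf.mp hx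
  set ι₀ := closureEmb (K := K) (v.adicCompletion K) with hι₀
  have h𝔓 := HeightOneSpectrum.primeBelow_mem_primesAbove (ι := ι₀) h𝔐
  haveI := h𝔓.1
  have hI : (v.primeBelow ι₀ 𝔐).inertia (absoluteGaloisGroup K) ≤ torsionFixing W n :=
    inertia_le_torsionFixing W (fun h ↦ h hgood) hnv ι₀ h𝔐
  obtain ⟨φ, rfl⟩ := oneCocycleClass_surjective (discreteTopRep (absoluteGaloisGroup K) (geomTorsion W (n : ℤ))) x
  have hφI : ∀ τ ∈ (v.primeBelow ι₀ 𝔐).inertia (absoluteGaloisGroup K), φ.1 τ = 0 :=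
    (W.oneCocycleClass_mem_selmerLocalKer_iff hgood hnv h𝔓 φ).mp hsel
  obtain ⟨P, hP⟩ := (oneCocycleClass_mem_ordinaryLocalKer_iff W hn h𝔐 φ).mp hord
  have hFD : F ∈ (v.primeBelow ι₀ 𝔐).decompositionSubgroup (absoluteGaloisGroup K) := hF.mem_stabilizer
  obtain ⟨m, hm⟩ := hstruct _ (hP F hFD F hFD)
  refine (oneCocycleClass_mem_torsionLocalKer_iff_apply_frob W hn h𝔐 hF hI φ hφI).mpr ⟨P + m, ?_⟩
  rw [smul_add, sub_eq_iff_eq_add.mp hm]; abel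

end Trans

/-! ## §5 (Line): `loc_v(H¹_f)` is cyclic when `E[n]/(F − 1)E[n]` has prime order (or is trivial) -/

section Line

variable [W.IsElliptic]

/-- **(Line) in structural form.** Let `v` be a place of good reduction, `v ∤ n` (`n ≠ 0`), `𝔓 = 𝔓_{ι₀,𝔐}`, `F` an
arithmetic Frobenius at `𝔓`; assume every `y ∈ E[n]` is either in `(F − 1)E[n]` or generates `E[n]` modulo
`(F − 1)E[n]` (the quotient has prime order or is trivial — any good place with `Frob_v ≠ 1` on `E[p]`, `p` prime).
Then ONE local class `ℓ ∈ H¹(K_v, E[n])` has every localisation of a class satisfying the Kummer condition at `v`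
among its integer multiples (`H¹_f = H¹_ur ≅ E[n]/(Frob_v − 1)` is cyclic; Bertolini–Darmon Lemma 2.6 ∕ koly U1).
Proof: by §3, if some `x₀` has `loc x₀ ≠ 0` then `φ_{x₀}(F)` generates the quotient, `φ_x(F) ≡ a φ_{x₀}(F)` and
`loc(x − a x₀) = 0`. [cite: BertoliniDarmon2005, §2.2 Lemma 2.6] [cite: GrossLMS1991, §7 (7.1), Prop. 9.6] -/
theorem exists_torsionLocMap_selmerLocalKer_eq_zsmul (hgood : W.HasGoodReductionAt v) {n : ℕ} (hn : n ≠ 0)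
    (hnv : ((n : ℤ) : 𝓞 K) ∉ v.asIdeal)
    {𝔐 : Ideal (HeightOneSpectrum.localAbsIntegers v)} (h𝔐 : 𝔐 ∈ v.localPrimesAbove)
    {F : absoluteGaloisGroup K}
    (hF : IsArithFrobAt (𝓞 K) F (v.primeBelow (closureEmb (K := K) (v.adicCompletion K)) 𝔐))
    (hprime : ∀ y : geomTorsion W (n : ℤ), (∃ m : geomTorsion W (n : ℤ), y = F • m - m) ∨
      ∀ z : geomTorsion W (n : ℤ), ∃ (a : ℤ) (m : geomTorsion W (n : ℤ)), z = a • y + (F • m - m)) :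
    ∃ ℓ, ∀ y ∈ selmerLocalKer W (v.adicCompletion K) n,
      ∃ a : ℤ, W.torsionLocMap (v.adicCompletion K) n y = a • ℓ := by
  set ι₀ := closureEmb (K := K) (v.adicCompletion K) with hι₀
  set Kv := v.adicCompletion K with hKv
  have h𝔓 := HeightOneSpectrum.primeBelow_mem_primesAbove (ι := ι₀) h𝔐
  have hI : (v.primeBelow ι₀ 𝔐).inertia (absoluteGaloisGroup K) ≤ torsionFixing W n :=
    inertia_le_torsionFixing W (fun h ↦ h hgood) hnv ι₀ h𝔐
  -- `loc y = 0 ⟺ y ∈ torsionLocalKer` (by `rfl`), and the criterion of §3 on unramified cocycles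
  have hcrit : ∀ φ : contOneCocycles (discreteTopRep (absoluteGaloisGroup K) (geomTorsion W (n : ℤ))),
      oneCocycleClass _ φ ∈ selmerLocalKer W Kv n →
      (W.torsionLocMap Kv n (oneCocycleClass _ φ) = 0 ↔ ∃ m : geomTorsion W (n : ℤ), φ.1 F = F • m - m) :=
    fun φ hφ ↦ oneCocycleClass_mem_torsionLocalKer_iff_apply_frob W hn h𝔐 hF hI φ
      ((W.oneCocycleClass_mem_selmerLocalKer_iff hgood hnv h𝔓 φ).mp hφ)
  by_cases h0 : ∃ y₀ ∈ selmerLocalKer W Kv n, W.torsionLocMap Kv n y₀ ≠ 0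
  swap
  · exact ⟨0, fun y hy ↦ ⟨0, by
      rw [zero_smul]
      by_contra h
      exact h0 ⟨y, hy, h⟩⟩⟩
  · obtain ⟨y₀, hy₀, hy₀0⟩ := h0
    refine ⟨W.torsionLocMap Kv n y₀, fun y hy ↦ ?_⟩
    obtain ⟨φ₀, rfl⟩ := oneCocycleClass_surjective (discreteTopRep (absoluteGaloisGroup K) (geomTorsion W (n : ℤ))) y₀
    obtain ⟨φ, rfl⟩ := oneCocycleClass_surjective (discreteTopRep (absoluteGaloisGroup K) (geomTorsion W (n : ℤ))) y
    -- `φ₀(F)` generates `E[n]` modulo `(F − 1)E[n]`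
    have hgen : ∀ z : geomTorsion W (n : ℤ), ∃ (a : ℤ) (m : geomTorsion W (n : ℤ)), z = a • φ₀.1 F + (F • m - m) := by
      rcases hprime (φ₀.1 F) with h | h
      · exact absurd ((hcrit φ₀ hy₀).mpr h) hy₀0
      · exact h
    obtain ⟨a, m, ham⟩ := hgen (φ.1 F)
    refine ⟨a, ?_⟩
    -- the class `y − a y₀` is Kummer at `v` and its cocycle `φ − a φ₀` has value `Fm − m` at `F`
    have hclass : oneCocycleClass _ (φ - a • φ₀) = oneCocycleClass _ φ - a • oneCocycleClass _ φ₀ := by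
      rw [oneCocycleClass_sub]
      congr 1
      exact map_zsmul (oneCocycleClassₗ (discreteTopRep (absoluteGaloisGroup K) (geomTorsion W (n : ℤ)))) a φ₀
    have hmem : oneCocycleClass _ (φ - a • φ₀) ∈ selmerLocalKer W Kv n := by
      rw [hclass]
      exact sub_mem hy (AddSubgroup.zsmul_mem _ hy₀ a)
    have hzero : W.torsionLocMap Kv n (oneCocycleClass _ (φ - a • φ₀)) = 0 := by
      refine (hcrit _ hmem).mpr ⟨m, ?_⟩
      change φ.1 F - a • φ₀.1 F = F • m - m
      rw [ham]; abel
    rw [hclass, map_sub, map_zsmul, sub_eq_zero] at hzero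
    exact hzero

end Line

end Summit.BirchSwinnertonDyer.Rank1Residual.X11b.Three.Koly.Method2.LocalFrob

end
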